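import Summits.ABC.IUTFork.Joshi.TestGenuinePinsVacuityDegreeCutMinkowski
import Summits.ABC.IUTFork.Joshi.TestGenuinePinsVacuitySqrtThree
import Literature.NumberTheory.NumberFields.QuarticSmallDiscriminant
import Literature.NumberTheory.NumberFields.MinkowskiQuarticSexticBounds
import Literature.IUT.LogVolume.RescaledCompletionInvariants
import HarnessLib

/-!
# Branch E TEST — the QUARTIC CELL of the genuine-carrier pins is KERNEL-EMPTY (R-J row Y-26, rider R-32)

Proof-only composition (abc-iut cell, D-0079 R-J «Joshi Y-discharge census», row Y-26 / E ROWS R-32; seat abc-iut-E-t42,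
gen 7; 0 definitions, no `Prop` fact, FACT rows used: none).  After R-23a/R-23b (abc-iut-f-072 p494478, abc-iut-E-t32
p493580/p494173/p494605 + `TestGenuinePinsVacuityDegreeCutMinkowski`) the pins at abc-iut-c312-7's genuine carrier
`settingPrVolSharp` force `[F:ℚ] ∈ {1, 4, 6}`.  THIS FILE closes the degree-`4` cell with NO table and NO new fact:

* `natAbs_discr_eq_of_pinnedRegions_settingPrVolSharp_of_finrank_eq_four` — pinned ∧ `[F:ℚ] = 4 ⇒ |d_F| ∈ {144, 48}`
  (`|d_F| = 4^#A·3^#B`, `#A, #B ≤ 2` from p494605; Minkowski `44 ≤ |d_F|`, abc-iut-E-t32's `MinkowskiQuarticSexticBounds`);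
* `exists_absNorm_eq_two_of_pinnedRegions_settingPrVolSharp_of_finrank_eq_four` — and some prime `v ∣ 2` of `F` has
  `N(v) = 2` (`#A = 2 ≥ 1`; the dyadic fixed-ball shape has `f = 1`);
* **`not_pinnedRegions_settingPrVolSharp_of_finrank_eq_four`** — hence the pins are KERNEL-EMPTY for EVERY quartic `F`:
  by this seat's kernel-checked Hunter–Pohst enumeration `Literature/NumberTheory/NumberFields/QuarticSmallDiscriminant.lean`
  (`exists_sq_eq_nonsquare_of_natAbs_discr`: a quartic field with `|d| ∈ {48, 144}` and an ideal of norm `2` contains `t`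
  with `t² = d`, `d ∈ ℤ` a non-square — Minkowski's ℓ¹ body on that ideal, an explicit finite box of characteristic
  quartics, and a `decide`d certificate table) composed with abc-iut-E-t43's
  `not_pinnedRegions_settingPrVolSharp_of_sq_eq_of_not_isSquare` (p488653: every `F ∋ √d` has empty pins);
* `finrank_eq_one_or_six_of_pinnedRegions_settingPrVolSharp` (+ `PinnedRegions3` forms) — with E-t32's degree cut:
  **pinned ⇒ `[F:ℚ] = 1 ∨ [F:ℚ] = 6`**; the on-paper residual is the (primitive) SEXTIC cell only (`|d_F| = 1728`,
  `r₂ ≥ 2`), Pohst's sextic tables being print, not kernel.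

HONEST SCOPE: OUR interface's pins at OUR sharp real container under Dupuy–Hilado's typed (Ind2); nothing here bears on
print's (xi-e)/(xi-f); locates / conditionally verifies; no abc claim; no side taken on any author.
[claim: Mochizuki2012, status: disputed] [cite: DupuyHilado2025, §4.9] [cite: NeukirchANT1999, Ch. III (2.14)]
[cite: EsmondeMurty1999, Ex. 6.5.12 and Ex. 6.5.21 p. 93]
-/

noncomputable section

open Set Function NumberField IsDedekindDomain Metric
open scoped Pointwise Classical

namespace Summit.ABC.IUTFork.Joshi

open Thm311 Thm311.Real Cor312 Cor312Vol Literature.IUT.LogThetaLattice Literature.IUT.LogVolume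
  Literature.IUT.HodgeTheaters Literature.NumberTheory.NumberFields
open Literature.NumberTheory.GaloisRepresentations.Ultrametric
open GenuinePinsResidual GenuinePinsDividingLine

variable {F : Type} [Field F] [NumberField F] (X : PilotData F)
  (M : Type) [Field M] [NumberField M]
  (archPk : ∀ (j : (thetaIndex X).Label) (vQ : (thetaIndex X).VQ), Set ((logShellsDH X (analyticLogv F)).Packet j vQ))
  (archSub : ∀ (j : (thetaIndex X).Label) (v : (thetaIndex X).V),
    Set ((logShellsDH X (analyticLogv F)).Packet j ((thetaIndex X).over v)))
  (Ψ : ℤ → ∀ v : (thetaIndex X).V, v ∈ (thetaIndex X).Vbad → Set ((logShellsDH X (analyticLogv F)).StarPacket v))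
  (act : ℤ → ∀ v : (thetaIndex X).V, v ∈ (thetaIndex X).Vbad →
    (logShellsDH X (analyticLogv F)).StarPacket v → Module.End ℚ ((logShellsDH X (analyticLogv F)).StarPacket v))
  (Mmod : ℤ → ∀ j : (thetaIndex X).LabelStar, Set ((logShellsDH X (analyticLogv F)).GlobalPacket j.1))
  (region : ℤ → ∀ j : (thetaIndex X).LabelStar, FinDivisor M → ∀ vQ : (thetaIndex X).VQ,
    Set ((logShellsDH X (analyticLogv F)).Packet j.1 vQ))
  (frobAdm : ℤ → ℤ → ∀ (j : (thetaIndex X).Label) (vQ : (thetaIndex X).VQ),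
    Set ((logShellsDH X (analyticLogv F)).Packet j vQ) → Prop)
  (frobLogvol : ℤ → ℤ → ∀ (j : (thetaIndex X).Label) (vQ : (thetaIndex X).VQ),
    Set ((logShellsDH X (analyticLogv F)).Packet j vQ) → ℝ)
  (frobΨ : ℤ → ℤ → ∀ v : (thetaIndex X).V, v ∈ (thetaIndex X).Vbad → Set ((logShellsDH X (analyticLogv F)).StarPacket v))
  (frobMmod : ℤ → ℤ → ∀ j : (thetaIndex X).LabelStar, Set ((logShellsDH X (analyticLogv F)).GlobalPacket j.1))
  (unitImage : ℤ → ℤ → ℕ → ∀ (j : (thetaIndex X).Label) (vQ : (thetaIndex X).VQ),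
    Set ((logShellsDH X (analyticLogv F)).Packet j vQ))
  (ballImage : ℤ → ℤ → ∀ (j : (thetaIndex X).Label) (vQ : (thetaIndex X).VQ),
    Set ((logShellsDH X (analyticLogv F)).Packet j vQ))
  (thetaDiv : ℤ → ℤ → LgpDivisor M (thetaIndex X).lstar)
  (n : ℤ) {HT : Type} {LogLink : HT → HT → Type} {IsFull : ∀ {s t : HT}, LogLink s t → Prop}
  (lat : LGPGaussianLogThetaLattice LogLink IsFull)
  {Frd : Type} {IsoF : Frd → Frd → Type} {Ob : Frd → Type} {realify : Frd → Frd} {Strip : Type}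
  {IsoS : Strip → Strip → Type} {Mv : ∀ v : (thetaIndex X).V, v ∈ (thetaIndex X).Vbad → Type}
  [∀ v h, Monoid (Mv v h)]
  (sig : GlobalLGPFrobenioidSignature (thetaIndex X).lstar (thetaIndex X).V (· ∈ (thetaIndex X).Vbad)
    Frd IsoF Ob realify Strip IsoS Mv)
  (split : SplittingMonoids Mv) {ObΔ : Type} {N : ∀ v : (thetaIndex X).V, v ∈ (thetaIndex X).Vbad → Type}
  [∀ v h, Monoid (N v h)] (qData : QPilotData ObΔ N)
  (t : ∀ (pp : Nat.Primes) (_ : Fin X.lstar) (x : (thetaIndex X).Fibre (.inr pp)),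
    haveI : Fact (pp : ℕ).Prime := ⟨pp.2⟩; kOf X pp.1 x)
  (tq : ∀ (pp : Nat.Primes) (x : (thetaIndex X).Fibre (.inr pp)), haveI : Fact (pp : ℕ).Prime := ⟨pp.2⟩; kOf X pp.1 x)
  (ρ : (∀ v : (thetaIndex X).V, v ∈ (thetaIndex X).Vbad → Set ((logShellsDH X (analyticLogv F)).StarPacket v)) →
    ∀ (j : (thetaIndex X).Label) (vQ : (thetaIndex X).VQ), Set ((logShellsDH X (analyticLogv F)).Packet j vQ))
  (qK : ∀ v : (thetaIndex X).V, v ∈ (thetaIndex X).Vbad → Set ((logShellsDH X (analyticLogv F)).StarPacket v))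
  (htq0 : ∀ pp x, tq pp x ≠ 0)
  (htq1 : ∀ (pp : Nat.Primes) (x : (thetaIndex X).Fibre (.inr pp)),
    haveI : Fact (pp : ℕ).Prime := ⟨pp.2⟩; placeOf X pp.1 x ∉ X.S → ‖tq pp x‖ = 1)



/-- **Pinned ∧ quartic ⇒ `|d_F| ∈ {144, 48}`**: `|d_F| = 4^#A·3^#B` with `#A, #B ≤ 2` (p494605) and Minkowski's `44 ≤ |d_F|`
in degree `4`. [cite: NeukirchANT1999, Ch. III (2.14)] [claim: Mochizuki2012, status: disputed] -/
theorem natAbs_discr_eq_of_pinnedRegions_settingPrVolSharp_of_finrank_eq_four (h4 : Module.finrank ℚ F = 4)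
    (hpin : Cor312Vol.PinnedRegions
      (LatticeSituation.ofShells (logShellsDH X (analyticLogv F)) M archPk archSub
        (summandPiecesPr X (logvAnalytic_analyticLogv (F := F))).Adm
        (summandPiecesPr X (logvAnalytic_analyticLogv (F := F))).logvol Ψ act Mmod region frobAdm frobLogvol frobΨ frobMmod
        unitImage ballImage thetaDiv)
      (settingPrVolSharp X (logvAnalytic_analyticLogv (F := F)) M archPk archSub Ψ act Mmod region n lat sig split qData tq t
        htq0 htq1) ρ qK) :
    (NumberField.discr F).natAbs = 144 ∨ (NumberField.discr F).natAbs = 48 := by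
  have hd := natAbs_discr_eq_of_pinnedRegions_settingPrVolSharp X M archPk archSub Ψ act Mmod region frobAdm frobLogvol frobΨ
      frobMmod unitImage ballImage thetaDiv n lat sig split qData t tq ρ qK htq0 htq1 hpin
  have hA := two_mul_card_ramifiedTwo_le_of_pinnedRegions_settingPrVolSharp X M archPk archSub Ψ act Mmod region frobAdm frobLogvol frobΨ
      frobMmod unitImage ballImage thetaDiv n lat sig split qData t tq ρ qK htq0 htq1 hpin
  have hB := two_mul_card_ramifiedThree_le_of_pinnedRegions_settingPrVolSharp X M archPk archSub Ψ act Mmod region frobAdm frobLogvol frobΨ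
      frobMmod unitImage ballImage thetaDiv n lat sig split qData t tq ρ qK htq0 htq1 hpin
  have h44 := fortyfour_le_abs_discr_of_finrank_eq_four F h4
  rw [h4] at hA hB
  rw [Int.abs_eq_natAbs, hd] at h44
  set A := ((placesOver F 2).filter fun v => v.asIdeal.ramificationIdx ℤ = 2).card
  set B := ((placesOver F 3).filter fun v => v.asIdeal.ramificationIdx ℤ = 2).card
  rw [hd]
  have hA2 : A ≤ 2 := by omega
  have hB2 : B ≤ 2 := by omega
  interval_cases A <;> interval_cases B <;> simp_all

/-- **Pinned ∧ quartic ⇒ a prime of norm `2`**: `#A = 2 ≥ 1` gives a ramified `v ∣ 2`, whose fixed-ball shape has residue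
degree `1`, so `N(v) = 2`. [cite: NeukirchANT1999, Ch. I §8] [claim: Mochizuki2012, status: disputed] -/
theorem exists_absNorm_eq_two_of_pinnedRegions_settingPrVolSharp_of_finrank_eq_four (h4 : Module.finrank ℚ F = 4)
    (hpin : Cor312Vol.PinnedRegions
      (LatticeSituation.ofShells (logShellsDH X (analyticLogv F)) M archPk archSub
        (summandPiecesPr X (logvAnalytic_analyticLogv (F := F))).Adm
        (summandPiecesPr X (logvAnalytic_analyticLogv (F := F))).logvol Ψ act Mmod region frobAdm frobLogvol frobΨ frobMmod
        unitImage ballImage thetaDiv)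
      (settingPrVolSharp X (logvAnalytic_analyticLogv (F := F)) M archPk archSub Ψ act Mmod region n lat sig split qData tq t
        htq0 htq1) ρ qK) :
    ∃ v : HeightOneSpectrum (𝓞 F), Ideal.absNorm v.asIdeal = 2 := by
  have hd := natAbs_discr_eq_of_pinnedRegions_settingPrVolSharp X M archPk archSub Ψ act Mmod region frobAdm frobLogvol frobΨ
      frobMmod unitImage ballImage thetaDiv n lat sig split qData t tq ρ qK htq0 htq1 hpin
  have hB := two_mul_card_ramifiedThree_le_of_pinnedRegions_settingPrVolSharp X M archPk archSub Ψ act Mmod region frobAdm frobLogvol frobΨ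
      frobMmod unitImage ballImage thetaDiv n lat sig split qData t tq ρ qK htq0 htq1 hpin
  have h44 := fortyfour_le_abs_discr_of_finrank_eq_four F h4
  rw [h4] at hB
  rw [Int.abs_eq_natAbs, hd] at h44
  have hApos : 0 < ((placesOver F 2).filter fun v => v.asIdeal.ramificationIdx ℤ = 2).card := by
    by_contra h0
    push Not at h0
    have hA0 : ((placesOver F 2).filter fun v => v.asIdeal.ramificationIdx ℤ = 2).card = 0 := by omega
    set B := ((placesOver F 3).filter fun v => v.asIdeal.ramificationIdx ℤ = 2).card
    rw [hA0] at h44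
    have hB2 : B ≤ 2 := by omega
    interval_cases B <;> simp_all
  obtain ⟨v, hv⟩ := Finset.card_pos.mp hApos
  rw [Finset.mem_filter] at hv
  haveI : Fact (Nat.Prime 2) := ⟨Nat.prime_two⟩
  have hv2 : ((2 : ℕ) : 𝓞 F) ∈ v.asIdeal := FixedBallShapes.natCast_mem_of_mem_placesOver hv.1
  rcases fixedBallShapes_two_of_pinnedRegions_settingPrVolSharp X M archPk archSub Ψ act Mmod region frobAdm frobLogvol frobΨ
      frobMmod unitImage ballImage thetaDiv n lat sig split qData t tq ρ qK htq0 htq1 hpin v hv2 with he1 | ⟨-, hf, -⟩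
  · exact absurd he1 (by rw [hv.2]; decide)
  · refine ⟨v, ?_⟩
    rw [Literature.IUT.LogVolume.absNorm_eq_pow_inertiaDeg F 2 v hv2, hf, pow_one]

/-- **THE QUARTIC CELL IS KERNEL-EMPTY: every number field `F` with `[F:ℚ] = 4` has KERNEL-EMPTY pins at `settingPrVolSharp`**
(analytic logarithms, every `X`, `ρ`, `qK`, column data, `Ψ`, ideles, column).  Pinned ⇒ `|d_F| ∈ {48, 144}` and a prime of
norm `2` ⇒ (kernel-checked Hunter–Pohst enumeration `exists_sq_eq_nonsquare_of_natAbs_discr`, no table) `F ∋ t` with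
`t² = d`, `d` a non-square integer ⇒ empty pins by p488653's `not_pinnedRegions_settingPrVolSharp_of_sq_eq_of_not_isSquare`.
[cite: EsmondeMurty1999, Ex. 6.5.12 and Ex. 6.5.21 p. 93] [claim: Mochizuki2012, status: disputed] -/
theorem not_pinnedRegions_settingPrVolSharp_of_finrank_eq_four (h4 : Module.finrank ℚ F = 4) :
    ¬ Cor312Vol.PinnedRegions
      (LatticeSituation.ofShells (logShellsDH X (analyticLogv F)) M archPk archSub
        (summandPiecesPr X (logvAnalytic_analyticLogv (F := F))).Adm
        (summandPiecesPr X (logvAnalytic_analyticLogv (F := F))).logvol Ψ act Mmod region frobAdm frobLogvol frobΨ frobMmod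
        unitImage ballImage thetaDiv)
      (settingPrVolSharp X (logvAnalytic_analyticLogv (F := F)) M archPk archSub Ψ act Mmod region n lat sig split qData tq t
        htq0 htq1) ρ qK := by
  intro hpin
  have hd := natAbs_discr_eq_of_pinnedRegions_settingPrVolSharp_of_finrank_eq_four X M archPk archSub Ψ act Mmod region frobAdm frobLogvol frobΨ
      frobMmod unitImage ballImage thetaDiv n lat sig split qData t tq ρ qK htq0 htq1 h4 hpin
  obtain ⟨v, hv⟩ := exists_absNorm_eq_two_of_pinnedRegions_settingPrVolSharp_of_finrank_eq_four X M archPk archSub Ψ act Mmod region frobAdm frobLogvol frobΨ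
      frobMmod unitImage ballImage thetaDiv n lat sig split qData t tq ρ qK htq0 htq1 h4 hpin
  obtain ⟨s, d, hs, hnd⟩ := exists_sq_eq_nonsquare_of_natAbs_discr h4 hd v.asIdeal hv
  exact not_pinnedRegions_settingPrVolSharp_of_sq_eq_of_not_isSquare X M archPk archSub Ψ act Mmod region frobAdm frobLogvol frobΨ
      frobMmod unitImage ballImage thetaDiv n lat sig split qData t tq ρ qK htq0 htq1 hs hnd hpin

/-- The same for `PinnedRegions3`. [claim: Mochizuki2012, status: disputed] -/
theorem not_pinnedRegions3_settingPrVolSharp_of_finrank_eq_four (h4 : Module.finrank ℚ F = 4) :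
    ¬ Cor312Vol.PinnedRegions3
      (LatticeSituation.ofShells (logShellsDH X (analyticLogv F)) M archPk archSub
        (summandPiecesPr X (logvAnalytic_analyticLogv (F := F))).Adm
        (summandPiecesPr X (logvAnalytic_analyticLogv (F := F))).logvol Ψ act Mmod region frobAdm frobLogvol frobΨ frobMmod
        unitImage ballImage thetaDiv)
      (settingPrVolSharp X (logvAnalytic_analyticLogv (F := F)) M archPk archSub Ψ act Mmod region n lat sig split qData tq t
        htq0 htq1) ρ qK :=
  fun h => not_pinnedRegions_settingPrVolSharp_of_finrank_eq_four X M archPk archSub Ψ act Mmod region frobAdm frobLogvol frobΨ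
      frobMmod unitImage ballImage thetaDiv n lat sig split qData t tq ρ qK htq0 htq1 h4 h.1

/-- **THE DEGREE CUT SHARPENED: `PinnedRegions` at `settingPrVolSharp` ⇒ `[F:ℚ] = 1 ∨ [F:ℚ] = 6`** (abc-iut-E-t32's
`finrank_eq_of_pinnedRegions_settingPrVolSharp` minus the quartic cell).  The on-paper residual is the sextic cell.
[cite: NeukirchANT1999, Ch. III (2.14)] [claim: Mochizuki2012, status: disputed] -/
theorem finrank_eq_one_or_six_of_pinnedRegions_settingPrVolSharp
    (hpin : Cor312Vol.PinnedRegions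
      (LatticeSituation.ofShells (logShellsDH X (analyticLogv F)) M archPk archSub
        (summandPiecesPr X (logvAnalytic_analyticLogv (F := F))).Adm
        (summandPiecesPr X (logvAnalytic_analyticLogv (F := F))).logvol Ψ act Mmod region frobAdm frobLogvol frobΨ frobMmod
        unitImage ballImage thetaDiv)
      (settingPrVolSharp X (logvAnalytic_analyticLogv (F := F)) M archPk archSub Ψ act Mmod region n lat sig split qData tq t
        htq0 htq1) ρ qK) :
    Module.finrank ℚ F = 1 ∨ Module.finrank ℚ F = 6 := by
  rcases finrank_eq_of_pinnedRegions_settingPrVolSharp X M archPk archSub Ψ act Mmod region frobAdm frobLogvol frobΨ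
      frobMmod unitImage ballImage thetaDiv n lat sig split qData t tq ρ qK htq0 htq1 hpin with h1 | h4 | h6
  · exact Or.inl h1
  · exact absurd hpin (not_pinnedRegions_settingPrVolSharp_of_finrank_eq_four X M archPk archSub Ψ act Mmod region frobAdm frobLogvol frobΨ
      frobMmod unitImage ballImage thetaDiv n lat sig split qData t tq ρ qK htq0 htq1 h4)
  · exact Or.inr h6

/-- The same read from `PinnedRegions3`. [claim: Mochizuki2012, status: disputed] -/
theorem finrank_eq_one_or_six_of_pinnedRegions3_settingPrVolSharp
    (hpin : Cor312Vol.PinnedRegions3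
      (LatticeSituation.ofShells (logShellsDH X (analyticLogv F)) M archPk archSub
        (summandPiecesPr X (logvAnalytic_analyticLogv (F := F))).Adm
        (summandPiecesPr X (logvAnalytic_analyticLogv (F := F))).logvol Ψ act Mmod region frobAdm frobLogvol frobΨ frobMmod
        unitImage ballImage thetaDiv)
      (settingPrVolSharp X (logvAnalytic_analyticLogv (F := F)) M archPk archSub Ψ act Mmod region n lat sig split qData tq t
        htq0 htq1) ρ qK) :
    Module.finrank ℚ F = 1 ∨ Module.finrank ℚ F = 6 :=
  finrank_eq_one_or_six_of_pinnedRegions_settingPrVolSharp X M archPk archSub Ψ act Mmod region frobAdm frobLogvol frobΨ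
      frobMmod unitImage ballImage thetaDiv n lat sig split qData t tq ρ qK htq0 htq1 hpin.1

/-- **Every number field `F` with `2 ≤ [F:ℚ]`, `[F:ℚ] ≠ 6` has KERNEL-EMPTY pins at `settingPrVolSharp`.**
[cite: NeukirchANT1999, Ch. III (2.14)] [claim: Mochizuki2012, status: disputed] -/
theorem not_pinnedRegions_settingPrVolSharp_of_two_le_finrank_of_ne_six (h2 : 2 ≤ Module.finrank ℚ F)
    (h6 : Module.finrank ℚ F ≠ 6) :
    ¬ Cor312Vol.PinnedRegions
      (LatticeSituation.ofShells (logShellsDH X (analyticLogv F)) M archPk archSub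
        (summandPiecesPr X (logvAnalytic_analyticLogv (F := F))).Adm
        (summandPiecesPr X (logvAnalytic_analyticLogv (F := F))).logvol Ψ act Mmod region frobAdm frobLogvol frobΨ frobMmod
        unitImage ballImage thetaDiv)
      (settingPrVolSharp X (logvAnalytic_analyticLogv (F := F)) M archPk archSub Ψ act Mmod region n lat sig split qData tq t
        htq0 htq1) ρ qK := by
  intro hpin
  rcases finrank_eq_one_or_six_of_pinnedRegions_settingPrVolSharp X M archPk archSub Ψ act Mmod region frobAdm frobLogvol frobΨ
      frobMmod unitImage ballImage thetaDiv n lat sig split qData t tq ρ qK htq0 htq1 hpin with h | h <;> omega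

end Summit.ABC.IUTFork.Joshi

end
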